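import Summits.AtomisticToContinuum.HydrodynamicLimit.Theorems.CollisionIsometryCLTMacroClosureBlockMGFPointwise
import Summits.AtomisticToContinuum.HydrodynamicLimit.Theorems.CollisionIsometryCLTMacroClosureBlockMGFShiftBound
import Summits.AtomisticToContinuum.HydrodynamicLimit.Theorems.CollisionIsometryCLTMacroClosureStubClausiusStatics
import Summits.AtomisticToContinuum.HydrodynamicLimit.Theorems.CollisionIsometryCLTMacroClosureEngineGoodEvent
import HarnessLib

/-!
# Two-scale block MGF (line `IdeatorTwoGen1Sketch`, crux `MacroClosure`, stmt-AtomisticToContinuum-14870):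
# the bound at fixed `N` (core)

Support file (`--supports stmt-AtomisticToContinuum-14870`) of the line lead (continuation c2) towards the registered
stub `Barycentric.stub_blockMGF_twoScale`: for ONE `N`, mesh `M`, side `ℓ = 1/M ≤ 1/64`, the two explicit kernels
`φ = b_ℓ ⋆ ψ_{ℓ/8}` and `φ₂ = ψ_{ℓ/128}`, the exponential moment of `γ'(N+1) 𝟙{two-scale band} ∫ₓ h⁺(Ū_φ | U_c)`
under the homogeneous local Gibbs law is at most `K^{M³} B + 1`, where `B` bounds the configurational integral of
`…BlockMGFPositionBound` uniformly in the shift: off the band the integrand is `1`; on the band (and off the null set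
of coincident velocities) the occupation floor/ceiling of every cube (hypothesis, from `stub_twoScale_occupation`)
feeds the pointwise reduction `pointwise_core`; Tonelli exchanges configuration and shift; at each shift the
velocities are integrated out by `shiftBound_core`.
-/

noncomputable section

open MeasureTheory Filter Set Topology InformationTheory
open scoped ENNReal ContDiff Convolution

namespace Summit.AtomisticToContinuum.HydrodynamicLimit.Theorems.MacroClosureLine

open Literature.MathematicalPhysics.KineticTheory Literature.Analysis.FluidPDE
open Literature.Analysis.FunctionSpaces
open Summit.AtomisticToContinuum.HydrodynamicLimit.Theses

namespace Barycentric

namespace BlockMGFTwoScale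

variable {N : ℕ}

/-- Under any local Gibbs law, almost every configuration has pairwise distinct velocities. [folklore] -/
theorem ae_pairwise_vel_ne_zero {σ : ℝ} (a₀ : T3 → ℝ) (u₀ : T3 → V3) (θ₀ : T3 → ℝ) (Φ : Flow σ N) :
    ∀ᵐ z ∂(localGibbsLaw σ a₀ u₀ θ₀ N Φ), ∀ i j : Fin (N + 1), i ≠ j → (z i).2 ≠ (z j).2 := by
  have hgood : ∀ᵐ z ∂(localGibbsLaw σ a₀ u₀ θ₀ N Φ), z ∈ Φ.good := by
    rw [ae_iff]
    simpa only [Set.compl_def] using localGibbsLaw_compl_good σ a₀ θ₀ u₀ N Φ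
  filter_upwards [Clausius.ae_pairwise_vel_ne (N := N) a₀ u₀ θ₀ Φ 0, hgood] with z hz hzg
  rwa [Φ.flow_zero z hzg] at hz

/-- `Z⁻¹ (B · Z) ≤ B` in `ℝ≥0∞` for a finite measure value `Z`. [folklore] -/
theorem ofReal_inv_toReal_mul_le {Z : ℝ≥0∞} (hZ : Z ≠ ⊤) (B : ℝ≥0∞) :
    ENNReal.ofReal (Z.toReal⁻¹) * (B * Z) ≤ B := by
  by_cases h0 : Z = 0
  · simp [h0]
  · have ht : 0 < Z.toReal := ENNReal.toReal_pos h0 hZ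
    have heq : ENNReal.ofReal (Z.toReal⁻¹) * (B * Z) = B := by
      calc ENNReal.ofReal (Z.toReal⁻¹) * (B * Z) = B * (ENNReal.ofReal (Z.toReal⁻¹) * ENNReal.ofReal Z.toReal) := by
            rw [ENNReal.ofReal_toReal hZ]; ring
        _ = B := by rw [← ENNReal.ofReal_mul (inv_nonneg.2 ht.le), inv_mul_cancel₀ ht.ne', ENNReal.ofReal_one, mul_one]
    exact heq.le

/-- **The two-scale block MGF at fixed `N` (core).** See the module docstring. Abstract mesh `M`, side `ℓ = 1/M`;
the rate facts (`hRb`, `hRid`), the velocity factorisation constants (`K, n₀, hVF`), the occupation floor/ceiling on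
the fine band (`hocc`) and the uniform configurational bound (`B, hPB`) are hypotheses in the forms of the landed
inputs. [folklore] -/
theorem mgf_core : ∀ (N M : ℕ), 0 < M → ∀ (ℓ : ℝ), ℓ = ((M : ℕ) : ℝ)⁻¹ → ℓ ≤ 1 / 64 →
    StiffCollisionalRelaxation.HsFreeEnergyConvex → ∀ (σ : ℝ), 0 < σ → σ ≤ 1 / 2 → ∀ (uc : V3) (θc : ℝ), 0 < θc →
    (∀ r : ℝ, 0 < r → r * σ ^ 3 < 11 / 10 → 0 ≤ confRate σ uc θc r) →
    (∀ (N : ℕ) (ℓ : ℝ), 0 < ℓ → ∀ (z : Config (N + 1) (Fin 3) T3) (y : T3),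
      (∃ i ∈ cellSet ℓ z y, ∃ j ∈ cellSet ℓ z y, (z i).2 ≠ (z j).2) →
      ((N : ℝ) + 1) * ℓ ^ 3 * relEnt σ (bU (boxKernel ℓ) z y) (stateOf 1 uc θc) =
        ((N : ℝ) + 1) * ℓ ^ 3 * confRate σ uc θc ((cellCount ℓ z y : ℝ) / (((N : ℝ) + 1) * ℓ ^ 3)) +
          cellKin uc θc ℓ z y ∧
      0 ≤ cellKin uc θc ℓ z y) →
    ∀ (γ' : ℝ), 0 < γ' → γ' ≤ 1 → ∀ (c₁ c₂ a K : ℝ) (n₀ : ℕ),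
    (∀ (ι : Type) [Fintype ι] (N : ℕ) (uc : V3) (θc : ℝ), 0 < θc → ∀ (ℓ : ℝ) (y : ι → T3) (q : Fin (N + 1) → T3),
      (∀ k k', k ≠ k' → Disjoint (cellSet ℓ (zipConfig (q, fun _ => (0 : V3))) (y k))
        (cellSet ℓ (zipConfig (q, fun _ => (0 : V3))) (y k'))) →
      (∀ k, n₀ < cellCount ℓ (zipConfig (q, fun _ => (0 : V3))) (y k)) →
      ∫⁻ v, ∏ k, ENNReal.ofReal (Real.exp (γ' * cellKin uc θc ℓ (zipConfig (q, v)) (y k)))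
          ∂(Measure.pi fun _ : Fin (N + 1) => gaussMeasure uc θc) ≤ ENNReal.ofReal K ^ Fintype.card ι) →
    (∀ z : Config (N + 1) (Fin 3) T3,
      (∀ x, c₂ ≤ bρ (Torus.kernel (ℓ / 128) : T3 → ℝ) z x ∧ bρ (Torus.kernel (ℓ / 128) : T3 → ℝ) z x * σ ^ 3 ≤ 1) →
      ∀ y, a * (((N : ℝ) + 1) * ℓ ^ 3) ≤ (cellCount ℓ z y : ℝ) ∧
        (cellCount ℓ z y : ℝ) * σ ^ 3 ≤ (1 + 1 / 64) ^ 3 * (((N : ℝ) + 1) * ℓ ^ 3)) →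
    2 ≤ a * (((N : ℝ) + 1) * ℓ ^ 3) → (n₀ : ℝ) < a * (((N : ℝ) + 1) * ℓ ^ 3) →
    ∀ (B : ℝ≥0∞), (∀ x : T3,
      ∫⁻ q, (posDomain (hsDiameter σ N) (N + 1)).indicator (fun q =>
          {q : Fin (N + 1) → T3 | ∀ κ : Fin 3 → Fin M,
              a * (((N : ℝ) + 1) * ℓ ^ 3) ≤
                (cellCount ℓ (zipConfig (q, fun _ => (0 : V3))) (x + Torus.proj (Torus.cellCorner M κ)) : ℝ) ∧
              (cellCount ℓ (zipConfig (q, fun _ => (0 : V3))) (x + Torus.proj (Torus.cellCorner M κ)) : ℝ) * σ ^ 3 ≤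
                (1 + 1 / 64) ^ 3 * (((N : ℝ) + 1) * ℓ ^ 3)}.indicator (fun q =>
            ∏ κ : Fin 3 → Fin M, ENNReal.ofReal (Real.exp (γ' * (((N : ℝ) + 1) * ℓ ^ 3) *
              confRate σ uc θc ((cellCount ℓ (zipConfig (q, fun _ => (0 : V3)))
                (x + Torus.proj (Torus.cellCorner M κ)) : ℝ) / (((N : ℝ) + 1) * ℓ ^ 3))))) q) q
        ≤ B * volume (posDomain (hsDiameter σ N) (N + 1))) →
    ∀ Φ : Flow σ N,
    ∫⁻ z, ENNReal.ofReal (Real.exp (γ' * ((N : ℝ) + 1) *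
        {z : Config (N + 1) (Fin 3) T3 |
            (∀ x, c₁ ≤ bρ (boxKernel ℓ ⋆ (Torus.kernel (ℓ / 8) : T3 → ℝ)) z x ∧
              bρ (boxKernel ℓ ⋆ (Torus.kernel (ℓ / 8) : T3 → ℝ)) z x * σ ^ 3 ≤ 1) ∧
            (∀ x, c₂ ≤ bρ (Torus.kernel (ℓ / 128) : T3 → ℝ) z x ∧
              bρ (Torus.kernel (ℓ / 128) : T3 → ℝ) z x * σ ^ 3 ≤ 1)}.indicator
          (fun z => ∫ x, max 0 (relEnt σ (bU (boxKernel ℓ ⋆ (Torus.kernel (ℓ / 8) : T3 → ℝ)) z x) (stateOf 1 uc θc))) z))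
      ∂(localGibbsLaw σ (fun _ => (1 : ℝ)) (fun _ => uc) (fun _ => θc) N Φ) ≤
    ENNReal.ofReal K ^ M ^ 3 * B + 1 := by
  intro N M hM ℓ hℓM hℓ64 hH σ hσ hσ2 uc θc hθc hRb hRid γ' hγ'0 hγ'1 c₁ c₂ a K n₀ hVF hocc h2a hn₀ B hPB Φ
  have hMR : (0 : ℝ) < (M : ℕ) := Nat.cast_pos.2 hM
  have hℓpos : 0 < ℓ := by rw [hℓM]; exact inv_pos.2 hMR
  have hℓ1 : ℓ ≤ 1 := hℓ64.trans (by norm_num)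
  set V : ℝ := ((N : ℝ) + 1) * ℓ ^ 3 with hV
  have hV0 : 0 < V := by positivity
  set φ : T3 → ℝ := boxKernel ℓ ⋆ (Torus.kernel (ℓ / 8) : T3 → ℝ) with hφ
  set φ₂ : T3 → ℝ := (Torus.kernel (ℓ / 128) : T3 → ℝ) with hφ₂
  set Uc : State := stateOf 1 uc θc with hUc
  set P : Measure (Config (N + 1) (Fin 3) T3) := localGibbsLaw σ (fun _ => (1 : ℝ)) (fun _ => uc) (fun _ => θc) N Φ
    with hP
  haveI : IsProbabilityMeasure P := isProbabilityMeasure_localGibbsLaw continuous_const continuous_const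
    continuous_const (fun _ => one_pos) (fun _ => hθc) hσ2 N Φ
  set band : Set (Config (N + 1) (Fin 3) T3) := {z | (∀ x, c₁ ≤ bρ φ z x ∧ bρ φ z x * σ ^ 3 ≤ 1) ∧
    (∀ x, c₂ ≤ bρ φ₂ z x ∧ bρ φ₂ z x * σ ^ 3 ≤ 1)} with hband
  set F : Config (N + 1) (Fin 3) T3 → ℝ := fun z => ∫ x, max 0 (relEnt σ (bU φ z x) Uc) with hF
  set c : (Fin 3 → Fin M) → T3 := fun κ => Torus.proj (Torus.cellCorner M κ) with hc
  -- the cell integrand `Θ z x`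
  set Aof : ℝ → ℝ≥0∞ := fun n => ENNReal.ofReal (Real.exp (γ' * V * confRate σ uc θc (n / V))) with hAof
  set Θ : Config (N + 1) (Fin 3) T3 → T3 → ℝ≥0∞ := fun z x =>
    {z : Config (N + 1) (Fin 3) T3 | ∀ κ, a * V ≤ (cellCount ℓ z (x + c κ) : ℝ) ∧
        (cellCount ℓ z (x + c κ) : ℝ) * σ ^ 3 ≤ (1 + 1 / 64) ^ 3 * V}.indicator (fun z =>
      ∏ κ, (Aof (cellCount ℓ z (x + c κ)) *
        ENNReal.ofReal (Real.exp (γ' * cellKin uc θc ℓ z (x + c κ))))) z with hΘ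
  -- Step 1: off the band the integrand is `1`; on it, it is `H`
  set H : Config (N + 1) (Fin 3) T3 → ℝ≥0∞ := fun z =>
    band.indicator (fun z => ENNReal.ofReal (Real.exp (γ' * ((N : ℝ) + 1) * F z))) z with hH'
  have hsplit : ∀ z, ENNReal.ofReal (Real.exp (γ' * ((N : ℝ) + 1) * band.indicator F z)) ≤ H z + 1 := by
    intro z
    by_cases hz : z ∈ band
    · rw [Set.indicator_of_mem hz]; simp only [hH', Set.indicator_of_mem hz]; exact le_self_add
    · rw [Set.indicator_of_notMem hz, mul_zero, Real.exp_zero, ENNReal.ofReal_one]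
      simp only [hH', Set.indicator_of_notMem hz, zero_add]; exact le_rfl
  -- Step 2: on the band (and off the coincidence null set), `H ≤ ∫ₓ Θ`
  have hHle : ∀ᵐ z ∂P, H z ≤ ∫⁻ x, Θ z x := by
    filter_upwards [ae_pairwise_vel_ne_zero (N := N) (fun _ => (1 : ℝ)) (fun _ => uc) (fun _ => θc) Φ] with z hv
    by_cases hz : z ∈ band
    swap
    · simp only [hH', Set.indicator_of_notMem hz]; exact zero_le
    simp only [hH', Set.indicator_of_mem hz]
    -- occupation floor and ceiling of every cube
    have hoc := hocc z hz.2
    have h2 : ∀ y, 2 ≤ cellCount ℓ z y := fun y => by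
      have := h2a.trans (hoc y).1; exact_mod_cast this
    have hpack : ∀ y, (cellCount ℓ z y : ℝ) * σ ^ 3 < 11 / 10 * (((N : ℝ) + 1) * ℓ ^ 3) := fun y =>
      (hoc y).2.trans_lt (by nlinarith [hV0])
    -- the pointwise reduction
    have hpt := pointwise_core N M hM ℓ hℓM hℓ1 hH σ hσ uc θc hRb hRid γ' hγ'0.le z hv h2 hpack
    refine hpt.trans (lintegral_mono fun x => ?_)
    have hzO : z ∈ {z : Config (N + 1) (Fin 3) T3 | ∀ κ, a * V ≤ (cellCount ℓ z (x + c κ) : ℝ) ∧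
        (cellCount ℓ z (x + c κ) : ℝ) * σ ^ 3 ≤ (1 + 1 / 64) ^ 3 * V} := fun κ => hoc _
    simp only [hΘ, Set.indicator_of_mem hzO]
    exact le_rfl
  -- Step 3: measurability of `Θ` on the product
  have hΘm : Measurable (Function.uncurry Θ) := by
    have hsh : ∀ κ, Measurable fun p : Config (N + 1) (Fin 3) T3 × T3 => (p.1, p.2 + c κ) := fun κ =>
      measurable_fst.prodMk (measurable_snd.add measurable_const)
    have hcnt : ∀ κ, Measurable fun p : Config (N + 1) (Fin 3) T3 × T3 => (cellCount ℓ p.1 (p.2 + c κ) : ℝ) := by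
      intro κ
      have h := (measurable_cellCount_real (N := N) ℓ).comp (hsh κ)
      dsimp only [Function.comp_def] at h
      exact h
    have hkin : ∀ κ, Measurable fun p : Config (N + 1) (Fin 3) T3 × T3 => cellKin uc θc ℓ p.1 (p.2 + c κ) := by
      intro κ
      have h := (measurable_cellKin (N := N) uc θc ℓ).comp (hsh κ)
      dsimp only [Function.comp_def] at h
      exact h
    have hA : ∀ κ, Measurable fun p : Config (N + 1) (Fin 3) T3 × T3 => Aof (cellCount ℓ p.1 (p.2 + c κ)) := by
      intro κ
      have hnat : Measurable fun p : Config (N + 1) (Fin 3) T3 × T3 => cellCount ℓ p.1 (p.2 + c κ) := by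
        refine measurable_to_countable' fun m => ?_
        have : (fun p : Config (N + 1) (Fin 3) T3 × T3 => cellCount ℓ p.1 (p.2 + c κ)) ⁻¹' {m} =
            {p | (cellCount ℓ p.1 (p.2 + c κ) : ℝ) = m} := by
          ext p; simp only [Set.mem_preimage, Set.mem_singleton_iff, Set.mem_setOf_eq, Nat.cast_inj]
        rw [this]
        exact measurableSet_eq_fun (hcnt κ) measurable_const
      exact (measurable_of_countable fun n : ℕ => Aof n).comp hnat
    have hO : MeasurableSet {p : Config (N + 1) (Fin 3) T3 × T3 | ∀ κ, a * V ≤ (cellCount ℓ p.1 (p.2 + c κ) : ℝ) ∧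
        (cellCount ℓ p.1 (p.2 + c κ) : ℝ) * σ ^ 3 ≤ (1 + 1 / 64) ^ 3 * V} := by
      have : {p : Config (N + 1) (Fin 3) T3 × T3 | ∀ κ, a * V ≤ (cellCount ℓ p.1 (p.2 + c κ) : ℝ) ∧
          (cellCount ℓ p.1 (p.2 + c κ) : ℝ) * σ ^ 3 ≤ (1 + 1 / 64) ^ 3 * V} =
          ⋂ κ, {p | a * V ≤ (cellCount ℓ p.1 (p.2 + c κ) : ℝ)} ∩
            {p | (cellCount ℓ p.1 (p.2 + c κ) : ℝ) * σ ^ 3 ≤ (1 + 1 / 64) ^ 3 * V} := by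
        ext p; simp only [Set.mem_setOf_eq, Set.mem_iInter, Set.mem_inter_iff]
      rw [this]
      exact MeasurableSet.iInter fun κ => (measurableSet_le measurable_const (hcnt κ)).inter
        (measurableSet_le ((hcnt κ).mul measurable_const) measurable_const)
    have hprod : Measurable fun p : Config (N + 1) (Fin 3) T3 × T3 =>
        ∏ κ, (Aof (cellCount ℓ p.1 (p.2 + c κ)) * ENNReal.ofReal (Real.exp (γ' * cellKin uc θc ℓ p.1 (p.2 + c κ)))) :=
      Finset.measurable_prod _ fun κ _ => (hA κ).mul ((measurable_const.mul (hkin κ)).exp.ennreal_ofReal)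
    have heq : Function.uncurry Θ =
        {p : Config (N + 1) (Fin 3) T3 × T3 | ∀ κ, a * V ≤ (cellCount ℓ p.1 (p.2 + c κ) : ℝ) ∧
          (cellCount ℓ p.1 (p.2 + c κ) : ℝ) * σ ^ 3 ≤ (1 + 1 / 64) ^ 3 * V}.indicator (fun p =>
          ∏ κ, (Aof (cellCount ℓ p.1 (p.2 + c κ)) *
            ENNReal.ofReal (Real.exp (γ' * cellKin uc θc ℓ p.1 (p.2 + c κ))))) := by
      funext p
      rcases p with ⟨z, x⟩
      simp only [Function.uncurry_apply_pair, hΘ]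
      by_cases hzx : ∀ κ, a * V ≤ (cellCount ℓ z (x + c κ) : ℝ) ∧
          (cellCount ℓ z (x + c κ) : ℝ) * σ ^ 3 ≤ (1 + 1 / 64) ^ 3 * V
      · rw [Set.indicator_of_mem (show z ∈ {z : Config (N + 1) (Fin 3) T3 | ∀ κ,
            a * V ≤ (cellCount ℓ z (x + c κ) : ℝ) ∧ (cellCount ℓ z (x + c κ) : ℝ) * σ ^ 3 ≤ (1 + 1 / 64) ^ 3 * V}
            from hzx),
          Set.indicator_of_mem (show ((z, x) : Config (N + 1) (Fin 3) T3 × T3) ∈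
            {p : Config (N + 1) (Fin 3) T3 × T3 | ∀ κ, a * V ≤ (cellCount ℓ p.1 (p.2 + c κ) : ℝ) ∧
              (cellCount ℓ p.1 (p.2 + c κ) : ℝ) * σ ^ 3 ≤ (1 + 1 / 64) ^ 3 * V} from hzx)]
      · rw [Set.indicator_of_notMem (show z ∉ {z : Config (N + 1) (Fin 3) T3 | ∀ κ,
            a * V ≤ (cellCount ℓ z (x + c κ) : ℝ) ∧ (cellCount ℓ z (x + c κ) : ℝ) * σ ^ 3 ≤ (1 + 1 / 64) ^ 3 * V}
            from hzx),
          Set.indicator_of_notMem (show ((z, x) : Config (N + 1) (Fin 3) T3 × T3) ∉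
            {p : Config (N + 1) (Fin 3) T3 × T3 | ∀ κ, a * V ≤ (cellCount ℓ p.1 (p.2 + c κ) : ℝ) ∧
              (cellCount ℓ p.1 (p.2 + c κ) : ℝ) * σ ^ 3 ≤ (1 + 1 / 64) ^ 3 * V} from hzx)]
    rw [heq]
    exact hprod.indicator hO
  -- Step 4: at each shift, integrate out the velocities and use the configurational bound
  have hshift : ∀ x : T3, ∫⁻ z, Θ z x ∂P ≤ ENNReal.ofReal K ^ M ^ 3 * B := by
    intro x
    have h1 := shiftBound_core N M hM ℓ hℓM σ a γ' uc θc hθc K n₀ hVF x hn₀ Φ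
    have hZ : volume (posDomain (hsDiameter σ N) (N + 1)) ≠ ⊤ := measure_ne_top _ _
    calc ∫⁻ z, Θ z x ∂P ≤ ENNReal.ofReal K ^ M ^ 3 *
          (ENNReal.ofReal ((volume (posDomain (hsDiameter σ N) (N + 1))).toReal⁻¹) *
            (B * volume (posDomain (hsDiameter σ N) (N + 1)))) := by
          refine h1.trans ?_
          gcongr
          exact hPB x
      _ ≤ ENNReal.ofReal K ^ M ^ 3 * B := by
          gcongr
          exact ofReal_inv_toReal_mul_le hZ B
  -- Step 5: Tonelli and assembly
  calc ∫⁻ z, ENNReal.ofReal (Real.exp (γ' * ((N : ℝ) + 1) * band.indicator F z)) ∂P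
      ≤ ∫⁻ z, (H z + 1) ∂P := lintegral_mono hsplit
    _ = (∫⁻ z, H z ∂P) + 1 := by rw [lintegral_add_right _ measurable_const, lintegral_const, measure_univ, mul_one]
    _ ≤ (∫⁻ z, (∫⁻ x, Θ z x ∂volume) ∂P) + 1 := add_le_add_left (lintegral_mono_ae hHle) _
    _ = (∫⁻ x, (∫⁻ z, Θ z x ∂P) ∂volume) + 1 := by rw [lintegral_lintegral_swap hΘm.aemeasurable]
    _ ≤ (∫⁻ _x : T3, ENNReal.ofReal K ^ M ^ 3 * B) + 1 := by gcongr with x; exact hshift x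
    _ = ENNReal.ofReal K ^ M ^ 3 * B + 1 := by rw [lintegral_const, measure_univ, mul_one]

end BlockMGFTwoScale

end Barycentric

end Summit.AtomisticToContinuum.HydrodynamicLimit.Theorems.MacroClosureLine

end
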